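import Literature.AlgebraicGeometry.Frobenioids.PadicFrobenioidPrimitive
import HarnessLib

/-!
# Frobenioids II, Example 1.1 (ii): the monogenic `p`-adic Frobenioid `Φ = ℤ_{≥0} · ord(c)` of a constant section `c`

Mochizuki, *The geometry of Frobenioids II*, Kyushu J. Math. **62** (2008) 401–460, §1, Example 1.1 (ii),
pp. 8–9 [cite: MochizukiFrdII2008, Ex 1.1 (ii) pp.8-9]: a monoprime subfunctor in monoids `Φ ⊆ Φ₀|_D` with
`B := B₀|_D ×_{Φ₀^gp|_D} Φ^gp → Φ^gp` nonzero determines a `p`-adic Frobenioid. The instance used at EVERY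
nonarchimedean place of [IUTchI] §3 is MONOGENIC: [IUTchI] Ex. 3.2 (iv)–(v) "the image of `q_v` determines a
constant section [i.e., a sub-monoid on `D_v` isomorphic to `ℕ`] `log_Φ(q_v)` of `Φ_{C_v}` … the resulting
submonoid `Φ_{C_v^⊢} := ℕ · log_Φ(q_v)|_{D_v^⊢}` … determines a `p_v`-adic Frobenioid with base category given by
`D_v^⊢` [cf. [FrdII], Example 1.1, (ii)]", and Ex. 3.3 (i) "`Φ_{C_v^⊢} : Spec L ↦ ord(ℤ_{p_v}^⊳)`" (`c = p_v`).

This file generalises `PadicFrobenioidPrimitive.lean` (the case `c = p`, kept there verbatim) from `p` to an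
arbitrary **constant section** `c = (c_A ∈ O_{K_A}^⊳)_A` of non-units compatible with the base
(`IsConstantSection`): `Monogenic`-style objects `gen` (`ord(c) ⊗ 1`), `Φc` (its powers, a subfunctor of `Φ₀|_D`
with bijective pull-backs), `ιc`, `Bc` (the fibre product), and

* `Datum.monogenic base hcs hloc hc he : Datum D p` — the `p`-adic Frobenioid datum generated by `c`
  (`ℤ`-monoprime; cartesian by construction; `Div_B` nonzero on the lift of `c`); NOT absolutely primitive in
  general (`ord(c)` need not lie in `ℤ · ord(p)`);
* `Datum.monogenic_generates` — every `ι(z)`, `z ∈ Φ^c(A)`, is a power of `Div₀(c_A)`: with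
  `IsConstantSection.units_map_eq` / `valuation_lt_one` this makes `c|_{K^×}` a splitting family, so that `c`
  determines a characteristic splitting `τ_c` (`Datum.cSplitting`, `PadicFrobenioidUnitSplittings.lean`).

Dictionary as in `PadicFrobenioid.lean`; no statement of the paper is strengthened.
-/

noncomputable section

namespace Literature.AlgebraicGeometry.Frobenioids

namespace PadicFrd

open CategoryTheory Opposite Function ValuativeRel

universe v u

variable {D : Type u} [Category.{v} D] {p : ℕ} (base : D ⥤ PadicFld.{u} p)

namespace Monogenic

/-! ### The generator `ord(c) ⊗ 1 ∈ Φ₀(A)` of a constant section `c` -/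

/-- A **constant section of `O^⊳` with positive valuation** over the base: nonzero integers
`c_A ∈ O_{K_A}^⊳` of valuation `< 1`, compatible with the restriction maps `O_{K_{A'}}^⊳ → O_{K_A}^⊳` of
`D → D₀` (e.g. `c = p`; `c =` a root of the `q`-parameter over a base on which it is defined, [IUTchI]
Ex. 3.2 (iv) "the image of `q_v` determines a constant section `log_Φ(q_v)` of `Φ_{C_v}`").
[cite: MochizukiFrdII2008, Ex 1.1 (ii) p.8] -/
structure IsConstantSection (c : ∀ A : D, intNonzero (base.obj A).K) : Prop where
  /-- compatibility with the restriction maps -/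
  map_eq : ∀ {A A' : D} (f : A ⟶ A'), intNonzeroMapOfHom (base.map f).alg (base.map f).isValHom (c A') = c A
  /-- positive valuation: `c_A` is not a unit of `O_{K_A}` -/
  not_isUnit : ∀ A : D, ¬ IsUnit (c A)

variable (c : ∀ A : D, intNonzero (base.obj A).K)

/-- `ord(c_A) ⊗ 1 ∈ Φ₀(A) = ord(O_{K_A}^⊳) ⊗ ℝ_{≥0}` ("`log_Φ(c)`"). [cite: MochizukiFrdII2008, Ex 1.1 (ii) p.8] -/
def gen (A : D) : Realification (OrdInt (base.obj A).K) :=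
  Realification.of (OrdInt (base.obj A).K) (Associates.mk (c A))

variable {c}

/-- The restriction maps of `Φ₀|_D` fix `ord(c) ⊗ 1` for a constant section `c`.
[cite: MochizukiFrdII2008, Ex 1.1 (ii) p.8] -/
theorem phi0Map_gen (hcs : IsConstantSection base c) {A A' : Dᵒᵖ} (f : A ⟶ A') :
    phi0Map base f (gen base c A.unop) = gen base c A'.unop := by
  change Realification.map (ordIntMapOfHom (base.map f.unop).alg (base.map f.unop).isValHom) (gen base c A.unop) = _
  rw [gen, Realification.map_of, ordIntMapOfHom_mk, gen, hcs.map_eq]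

/-! ### The subfunctor `Φ^c = ℤ_{≥0} · ord(c) ⊆ Φ₀|_D` -/

/-- The pull-back map of `Φ^c` along `f` (in `Dᵒᵖ`): the restriction of that of `Φ₀|_D` to the powers of
`ord(c) ⊗ 1`, which it preserves. [cite: MochizukiFrdII2008, Ex 1.1 (ii) p.8] -/
def ΦMap (hcs : IsConstantSection base c) {A A' : Dᵒᵖ} (f : A ⟶ A') :
    Submonoid.powers (gen base c A.unop) →* Submonoid.powers (gen base c A'.unop) :=
  ((phi0Map base f).restrict (Submonoid.powers (gen base c A.unop))).codRestrict _ fun x => by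
    obtain ⟨n, hn⟩ := x.2
    refine ⟨n, ?_⟩
    change gen base c A'.unop ^ n = phi0Map base f x.1
    rw [← hn, map_pow, phi0Map_gen base hcs]

/-- The value of the pull-back map of `Φ^c`. [cite: MochizukiFrdII2008, Ex 1.1 (ii) p.8] -/
@[simp] theorem coe_ΦMap (hcs : IsConstantSection base c) {A A' : Dᵒᵖ} (f : A ⟶ A') (x : Submonoid.powers (gen base c A.unop)) :
    (ΦMap base hcs f x : Realification (OrdInt (base.obj A'.unop).K)) = phi0Map base f x.1 := rfl

/-- **`Φ^c := ℤ_{≥0} · ord(c) ⊆ Φ₀|_D`** as a functor `Dᵒᵖ → CommMon`: `A ↦` the powers of `ord(c) ⊗ 1`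
(a "constant section … isomorphic to `ℕ`" of `Φ₀|_D`, [IUTchI] Ex. 3.2 (iv)). [cite: MochizukiFrdII2008, Ex 1.1 (ii) p.8] -/
def Φc (hcs : IsConstantSection base c) : Dᵒᵖ ⥤ CommMonCat.{u} where
  obj A := CommMonCat.of (Submonoid.powers (gen base c A.unop))
  map f := CommMonCat.ofHom (ΦMap base hcs f)
  map_id A := by
    apply CommMonCat.hom_ext
    refine MonoidHom.ext fun x => Subtype.ext ?_
    show phi0Map base (𝟙 A) x.1 = x.1
    rw [phi0Map_id]
    rfl
  map_comp f g := by
    apply CommMonCat.hom_ext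
    refine MonoidHom.ext fun x => Subtype.ext ?_
    show phi0Map base (f ≫ g) x.1 = phi0Map base g (phi0Map base f x.1)
    rw [phi0Map_comp]
    rfl

/-- The inclusion `Φ^c ↪ Φ₀|_D`. [cite: MochizukiFrdII2008, Ex 1.1 (ii) p.8] -/
def ιc (hcs : IsConstantSection base c) : Φc base hcs ⟶ phiZeroOn base where
  app A := CommMonCat.ofHom (Submonoid.subtype _)
  naturality {A A'} f := by
    apply CommMonCat.hom_ext
    exact MonoidHom.ext fun x => rfl

/-- The inclusion is objectwise injective. [cite: MochizukiFrdII2008, Ex 1.1 (ii) p.8] -/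
theorem ι_injective (hcs : IsConstantSection base c) (A : Dᵒᵖ) : Injective ((ιc base hcs).app A).hom := Subtype.val_injective

/-! ### The fibre product `B^c := B₀|_D ×_{Φ₀^gp|_D} (Φ^c)^gp` -/

/-- `B^c(A) ⊆ K_A^× × (Φ^c(A))^gp`: the pairs `(x, γ)` with `Div₀(x) = ι^gp(γ)` (the fibre product of
FrdII Ex. 1.1 (ii), p. 8, as an equaliser submonoid). [cite: MochizukiFrdII2008, Ex 1.1 (ii) p.8] -/
def BSub (hcs : IsConstantSection base c) (A : Dᵒᵖ) :
    Submonoid ((bZeroOn base).obj A × Algebra.GrothendieckGroup ((Φc base hcs).obj A)) :=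
  MonoidHom.eqLocusM (((divZeroOn base).app A).hom.comp (MonoidHom.fst _ _))
    (((Functor.whiskerRight (ιc base hcs) MonGp.functor).app A).hom.comp (MonoidHom.snd _ _))

/-- Membership in `B^c(A)`. [cite: MochizukiFrdII2008, Ex 1.1 (ii) p.8] -/
theorem mem_BSub_iff (hcs : IsConstantSection base c) (A : Dᵒᵖ) (q : (bZeroOn base).obj A × Algebra.GrothendieckGroup ((Φc base hcs).obj A)) :
    q ∈ BSub base hcs A ↔
      ((divZeroOn base).app A).hom q.1 = ((Functor.whiskerRight (ιc base hcs) MonGp.functor).app A).hom q.2 :=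
  Iff.rfl

/-- The pull-back map of `B^c` along `f`: `(x, γ) ↦ (B₀(f)(x), (Φ^c)^gp(f)(γ))`, which preserves the fibre
product condition by naturality of `B₀ → Φ₀^gp` and of `ι`. [cite: MochizukiFrdII2008, Ex 1.1 (ii) p.8] -/
def BMap (hcs : IsConstantSection base c) {A A' : Dᵒᵖ} (f : A ⟶ A') : BSub base hcs A →* BSub base hcs A' :=
  ((MonoidHom.prodMap ((bZeroOn base).map f).hom ((monoidGp (Φc base hcs)).map f).hom).comp
    (Submonoid.subtype _)).codRestrict _ fun q => by
    obtain ⟨⟨x, γ⟩, hq⟩ := q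
    have hq' : ((divZeroOn base).app A).hom x =
        ((Functor.whiskerRight (ιc base hcs) MonGp.functor).app A).hom γ := hq
    have n1 := congrArg (fun φ => φ.hom x) ((divZeroOn base).naturality f)
    have n2 := congrArg (fun φ => φ.hom γ) ((Functor.whiskerRight (ιc base hcs) MonGp.functor).naturality f)
    simp only [CommMonCat.hom_comp, MonoidHom.comp_apply] at n1 n2
    show ((divZeroOn base).app A').hom (((bZeroOn base).map f).hom x) =
      ((Functor.whiskerRight (ιc base hcs) MonGp.functor).app A').hom (((monoidGp (Φc base hcs)).map f).hom γ)
    exact n1.trans ((congrArg ((monoidGp (phiZeroOn base)).map f).hom hq').trans n2.symm)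

/-- **`B^c := B₀|_D ×_{Φ₀^gp|_D} (Φ^c)^gp`** as a functor `Dᵒᵖ → CommMon`. [cite: MochizukiFrdII2008, Ex 1.1 (ii) p.8] -/
def Bc (hcs : IsConstantSection base c) : Dᵒᵖ ⥤ CommMonCat.{u} where
  obj A := CommMonCat.of (BSub base hcs A)
  map f := CommMonCat.ofHom (BMap base hcs f)
  map_id A := by
    apply CommMonCat.hom_ext
    refine MonoidHom.ext fun q => Subtype.ext (Prod.ext ?_ ?_)
    · exact (DFunLike.congr_fun (congrArg CommMonCat.Hom.hom ((bZeroOn base).map_id A)) q.1.1).trans rfl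
    · exact (DFunLike.congr_fun (congrArg CommMonCat.Hom.hom ((monoidGp (Φc base hcs)).map_id A)) q.1.2).trans rfl
  map_comp f g := by
    apply CommMonCat.hom_ext
    refine MonoidHom.ext fun q => Subtype.ext (Prod.ext ?_ ?_)
    · exact (DFunLike.congr_fun (congrArg CommMonCat.Hom.hom ((bZeroOn base).map_comp f g)) q.1.1).trans rfl
    · exact (DFunLike.congr_fun (congrArg CommMonCat.Hom.hom ((monoidGp (Φc base hcs)).map_comp f g)) q.1.2).trans
        rfl

/-- The first projection `B^c → B₀|_D` ("`u ↦ u|_{K^×}`"). [cite: MochizukiFrdII2008, Ex 1.1 (ii) p.8] -/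
def toB0c (hcs : IsConstantSection base c) : Bc base hcs ⟶ bZeroOn base where
  app A := CommMonCat.ofHom ((MonoidHom.fst _ _).comp (Submonoid.subtype _))
  naturality {A A'} f := by
    apply CommMonCat.hom_ext
    exact MonoidHom.ext fun q => rfl

/-- The second projection `Div_B : B^c → (Φ^c)^gp`. [cite: MochizukiFrdII2008, Ex 1.1 (ii) p.8] -/
def divBc (hcs : IsConstantSection base c) : Bc base hcs ⟶ monoidGp (Φc base hcs) where
  app A := CommMonCat.ofHom ((MonoidHom.snd _ _).comp (Submonoid.subtype _))
  naturality {A A'} f := by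
    apply CommMonCat.hom_ext
    exact MonoidHom.ext fun q => rfl

/-- The element of `B^c(A)` over `(c_A, ord(c_A))`: the lift of `c_A ∈ K_A^×`, witnessing that `Div_B` is
nonzero. [cite: MochizukiFrdII2008, Ex 1.1 (ii) p.8] -/
def liftGen (hcs : IsConstantSection base c) (A : Dᵒᵖ) : BSub base hcs A :=
  ⟨(intNonzeroToUnits (base.obj A.unop).K (c A.unop),
    Algebra.GrothendieckGroup.of (⟨gen base c A.unop, Submonoid.mem_powers _⟩ : Submonoid.powers _)), by
    rw [mem_BSub_iff]
    change divZeroHom (base.obj A.unop).K (intNonzeroToUnits _ _) =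
      MonGp.map ((ιc base hcs).app A).hom (Algebra.GrothendieckGroup.of _)
    rw [divZeroHom_intNonzeroToUnits, MonGp.map_of]
    rfl⟩

/-- The constant section restricted to `K^×` is compatible with the field homomorphisms of the base.
[cite: MochizukiFrdII2008, Ex 1.1 (ii) p.8] -/
theorem IsConstantSection.units_map_eq (hcs : IsConstantSection base c) {A A' : D} (f : A ⟶ A') :
    Units.map ((base.map f).alg : (base.obj A').K →* (base.obj A).K) (intNonzeroToUnits (base.obj A').K (c A')) =
      intNonzeroToUnits (base.obj A).K (c A) := by
  rw [← hcs.map_eq f]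
  exact Units.ext rfl

/-- The constant section has valuation `< 1`. [cite: MochizukiFrdII2008, Ex 1.1 (ii) p.8] -/
theorem IsConstantSection.valuation_lt_one (hcs : IsConstantSection base c) (A : D) :
    valuation (base.obj A).K ((intNonzeroToUnits (base.obj A).K (c A) : (base.obj A).Kˣ) : (base.obj A).K) < 1 :=
  lt_of_le_of_ne (c A).2.1 fun h => hcs.not_isUnit A ((isUnit_intNonzero_iff _ _).mpr h)

/-! ### Arithmetic input: `ord(c) ⊗ 1` is non-torsion (base objects finite over `ℚ_p`) -/

section PadicLocal

variable [Fact p.Prime]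

/-- `ord(c_A) ⊗ 1 ≠ 1` in `Φ₀(A)` for a `p`-adic local field `K_A` (`c_A` is a non-unit, and `ord(O_K^⊳) → Φ₀`
is injective since `ord(O_K^⊳)` is monoprime, abc-iut-L1-d10). [cite: MochizukiFrdII2008, Ex 1.1 (i) p.7] -/
theorem gen_ne_one (hcs : IsConstantSection base c) {A : D} (hloc : (base.obj A).IsPadicLocal) : gen base c A ≠ 1 := by
  obtain ⟨⟨inst, hfin, hc⟩⟩ := hloc
  letI := inst
  haveI := hfin
  intro h
  have h2 : Associates.mk (c A) = 1 := Realification.of_injective (isMonoprime_ordInt hc) (h.trans (map_one _).symm)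
  rw [Associates.mk_eq_one] at h2
  exact hcs.not_isUnit A h2

/-- The powers of `ord(c) ⊗ 1` are distinct (`Φ₀(A)` is cancellative and sharp, `ord(p) ⊗ 1 ≠ 1`), so that
`ℤ_{≥0} · ord(c) ≅ ℤ_{≥0}`. [cite: MochizukiFrdII2008, Ex 1.1 (ii) p.8] -/
theorem gen_pow_injective (hcs : IsConstantSection base c) {A : D} (hloc : (base.obj A).IsPadicLocal) :
    Injective fun n : ℕ => gen base c A ^ n := by
  obtain ⟨⟨inst, hfin, hc⟩⟩ := id hloc
  letI := inst
  haveI := hfin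
  haveI := isCancelMul_realification (OrdInt (base.obj A).K)
  have hsharp : IsSharp (Realification (OrdInt (base.obj A).K)) :=
    (IsMonoprime.ofR (isRMonoprime_realification (isMonoprime_ordInt hc))).isSharp
  have key : ∀ m n : ℕ, m < n → gen base c A ^ m = gen base c A ^ n → False := by
    intro m n hlt hmn
    have h2 : gen base c A ^ m * gen base c A ^ (n - m) = gen base c A ^ m * 1 := by
      rw [← pow_add, Nat.add_sub_cancel' hlt.le, ← hmn, mul_one]
    exact gen_ne_one base hcs hloc
      (hsharp.1 _ (IsUnit.of_pow_eq_one (mul_left_cancel h2) (Nat.sub_ne_zero_of_lt hlt)))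
  intro m n hmn
  by_contra hne
  rcases Nat.lt_or_gt_of_ne hne with hlt | hlt
  · exact key m n hlt hmn
  · exact key n m hlt hmn.symm

/-- **All pull-back maps of `Φ^c` are bijective** (`ord(c)^n ⊗ 1 ↦ ord(c)^n ⊗ 1`; "a constant section",
[IUTchI] Ex. 3.2 (iv)). [cite: MochizukiFrdII2008, Ex 1.1 (ii) p.8] -/
theorem Φ_map_bijective (hcs : IsConstantSection base c) (hloc : ∀ A : D, (base.obj A).IsPadicLocal) {A A' : Dᵒᵖ} (f : A ⟶ A') :
    Bijective ((Φc base hcs).map f).hom := by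
  have hval : ∀ n : ℕ, phi0Map base f (gen base c A.unop ^ n) = gen base c A'.unop ^ n := fun n => by
    rw [map_pow, phi0Map_gen base hcs]
  constructor
  · rintro ⟨x, n, rfl⟩ ⟨y, m, rfl⟩ h
    have h' : phi0Map base f (gen base c A.unop ^ n) = phi0Map base f (gen base c A.unop ^ m) :=
      congrArg Subtype.val h
    rw [hval, hval] at h'
    have hnm : n = m := gen_pow_injective base hcs (hloc _) h'
    subst hnm
    rfl
  · rintro ⟨y, n, rfl⟩
    exact ⟨⟨gen base c A.unop ^ n, n, rfl⟩, Subtype.ext (hval n)⟩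

/-! ### The absolutely primitive datum -/

/-- **The monogenic `p`-adic Frobenioid datum generated by a constant section `c`** over a base `D → D₀` of
`p`-adic local fields (FrdII Ex. 1.1 (ii) with `Φ := ℤ_{≥0} · ord(c) ⊆ Φ₀|_D`, `Λ = ℤ`; [IUTchI] Ex. 3.2 (v)
"`Φ_{C_v^⊢} := ℕ · log_Φ(q_v)|_{D_v^⊢} ⊆ Φ_{C_v}|_{D_v^⊢}` determines a `p_v`-adic Frobenioid … [cf. [FrdII],
Example 1.1, (ii)]", and Ex. 3.3 (i) with `c = p_v`): `Φ^c ⊆ Φ₀|_D` is a `ℤ`-monoprime subfunctor in monoids,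
`B^c := B₀|_D ×_{Φ₀^gp} (Φ^c)^gp` is cartesian by construction, and `Div_B` is nonzero on the lift of `c`. Hypotheses as for `Datum.zero`: the base objects are
finite extensions of `ℚ_p` (`hloc`), `D` is connected and totally epimorphic. [cite: MochizukiFrdII2008, Ex 1.1 (ii) p.8] -/
def _root_.Literature.AlgebraicGeometry.Frobenioids.PadicFrd.Datum.monogenic (hcs : IsConstantSection base c) (hloc : ∀ A : D, (base.obj A).IsPadicLocal) (hc : IsConnected D) (he : IsTotallyEpimorphic D) :
    Datum D p where
  base := base
  isPadicLocal := hloc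
  isConnected_base := hc
  isTotallyEpimorphic_base := he
  Φ := Φc base hcs
  ι := ιc base hcs
  ι_injective := ι_injective base hcs
  isMonoprime A := by
    classical
    exact IsMonoprime.ofZ ⟨⟨(Submonoid.powLogEquiv (gen_pow_injective base hcs (hloc A.unop))).symm⟩⟩
  B := Bc base hcs
  toB0 := toB0c base hcs
  divB := divBc base hcs
  square := by
    refine NatTrans.ext (funext fun A => ?_)
    rw [NatTrans.comp_app, NatTrans.comp_app]
    apply CommMonCat.hom_ext
    rw [CommMonCat.hom_comp, CommMonCat.hom_comp]
    exact MonoidHom.ext fun q => q.2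
  cartesian A := by
    constructor
    · intro b b' h
      exact Subtype.ext (congrArg Subtype.val h)
    · rintro ⟨q, hq⟩
      exact ⟨⟨q, hq⟩, rfl⟩
  nonzero A := by
    refine ⟨liftGen base hcs A, fun h => gen_ne_one base hcs (hloc A.unop) ?_⟩
    haveI := isCancelMul_realification (OrdInt (base.obj A.unop).K)
    have h1 : Algebra.GrothendieckGroup.of
        (⟨gen base c A.unop, Submonoid.mem_powers _⟩ : Submonoid.powers (gen base c A.unop)) = 1 := h
    have h2 := congrArg (MonGp.map (Submonoid.powers (gen base c A.unop)).subtype) h1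
    rw [MonGp.map_of, map_one, Submonoid.subtype_apply] at h2
    exact Algebra.GrothendieckGroup.of_injective (h2.trans (map_one _).symm)

/-- All pull-back maps of the divisor monoid `Φ^c` of the monogenic datum are bijective.
[cite: MochizukiFrdII2008, Ex 1.1 (ii) p.8] -/
theorem _root_.Literature.AlgebraicGeometry.Frobenioids.PadicFrd.Datum.monogenic_map_Φ_bijective (hcs : IsConstantSection base c) (hloc : ∀ A : D, (base.obj A).IsPadicLocal) (hc : IsConnected D)
    (he : IsTotallyEpimorphic D) {A A' : D} (f : A ⟶ A') :
    Bijective ((Datum.monogenic base hcs hloc hc he).Φ.map f.op).hom :=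
  Φ_map_bijective base hcs hloc f.op

/-- In the monogenic datum, `ι(z)` is a (nonnegative) power of `Div₀(c_A)` for every `z ∈ Φ^c(A)` — the
`generates` clause of a splitting family (`Datum.IsSplittingFamily`, `PadicFrobenioidUnitSplittings.lean`), so
that `c` determines a characteristic splitting `τ_c` on the associated Frobenioid ([IUTchI] Ex. 3.2 (v):
"`q_v` determines a `μ_{2l}(−)`-orbit of characteristic splittings `τ_v^⊢`"). [cite: MochizukiFrdII2008, Thm 1.2 (v) p.10] -/
theorem _root_.Literature.AlgebraicGeometry.Frobenioids.PadicFrd.Datum.monogenic_generates (hcs : IsConstantSection base c) (hloc : ∀ A : D, (base.obj A).IsPadicLocal)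
    (hc : IsConnected D) (he : IsTotallyEpimorphic D) (A : D) (z : (Datum.monogenic base hcs hloc hc he).Φ.obj (op A)) :
    ∃ k : ℕ, MonGp.map ((Datum.monogenic base hcs hloc hc he).ιHom A) (Algebra.GrothendieckGroup.of z) =
      divZeroHom (base.obj A).K (intNonzeroToUnits (base.obj A).K (c A)) ^ k := by
  obtain ⟨x, k, rfl⟩ := z
  refine ⟨k, ?_⟩
  rw [MonGp.map_of, divZeroHom_intNonzeroToUnits, ← map_pow]
  rfl

end PadicLocal

end Monogenic

end PadicFrd

end Literature.AlgebraicGeometry.Frobenioids
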